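import Summits.BirchSwinnertonDyer.BirchSwinnertonDyer.Theorems.ClassRecordThreeCornerAtThreeShimuraFamilyLevelData
import Summits.BirchSwinnertonDyer.BirchSwinnertonDyer.Theorems.ErratumRoadFiveShimuraKolyvaginOrderBoundInertCarrierGlue
import Summits.BirchSwinnertonDyer.BirchSwinnertonDyer.Theorems.ErratumRoadFiveShimuraKolyvaginOrderBoundInertCarrierChoiceFree
import Literature.NumberTheory.EllipticCurves.BSDRankZeroDensity
import HarnessLib

/-!
# CHOICE-FREENESS of Kolyvagin's class for the GENERALISED datum: two data at the same level with the same point `y(n)` have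
# `P₂ = u•P₁ + p^M b`, the SAME subgroup `E(K[n]) ⊆ E(K̄)`, `c_M(d₂) = u • c_M(d₁)` with `p ∤ u`, and all local orders agree
# (cell `bsd-stepL`, seat `bsd-stepL-corner3-p2` g8 = WIDTH-LEVER lane B; `--supports stmt-BirchSwinnertonDyer-21420 --as helper`)

WHY (CORNER3-G8.md §4; tam3-p1 g13's GROSS-keyed (P2) assembly `Koly.familyLevelSupply_of_memberships`). That assembly quantifies
EVERY producer over ALL data `d : JET.KolyvaginFamilyData W K ι n` with `d.y = ys n` — arbitrary generators `σ_q`, transversal `S`,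
embedding `K[n] → K̄` — and its `h47` compares the local orders of the classes of two UNRELATED data `d` (level `n`) and `d'` (level
`nℓ`). The label-consuming producers of lane B (key relation p601020) are proved for COHERENT data. THIS FILE closes the gap once and
for all: Kolyvagin's class of the generalised datum depends on `(σ, S, emb)` only up to a unit of `ℤ/p^M` (Gross 1991 §4: *"the class
of `P_n` in `E(K_n)/p^M E(K_n)` does not depend on the choice of coset representatives"*; the generator `σ_q ↦ σ_q^a` rescales `D_q`
by the unit `a⁻¹` modulo `p^M` and the `G_n`-trace, shim-p1's `exists_isCoprime_kolyvaginPoint_eq_of_presentations_of_pow_eq_one`; two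
`K`-embeddings of the Galois extension `K[n]/K` differ by `γ ∈ 𝒢_n`, x11b3's `RingClassConj.exists_algEquiv_forall_apply_eq`, and
`[P_n]` is `𝒢_n`-invariant, Gross Prop. 3.6 ∕ McCallum (4)).

RESULTS (namespace `Summit.BirchSwinnertonDyer.BirchSwinnertonDyer.Theorems.ShimuraWalk`), for `d₁ d₂ : KolyvaginFamilyData W K ι n`,
`n` square-free with Gross–Kolyvagin prime factors of depth `≥ M ≥ 1`, (B4) at level `n` in the `∃ y'` form:
* `exists_familyData_presentation` — the datum as a PRESENTATION `(σ, H_c, f)` in `𝒢_n` with `P(σ, f, y) = d.derivedPoint` (H37 bridge).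
* `exists_isCoprime_derivedPoint_eq_smul_add` — `d₂.y = d₁.y ⟹ ∃ u, IsCoprime u p^M ∧ ∃ b, P₂ = u • P₁ + p^M • b` in `E(K[n])`.
* `familyData_toGeomPoints_eq_of_emb`, `familyData_pointsSubgroup_eq` — two data at one level have the same `E(K[n]) ⊆ E(K̄)`.
* `exists_isCoprime_toGeomPoints_derivedPoint_eq_smul_add` — the same in `E(K̄)`: `j₂ P₂ = u • j₁ P₁ + p^M • B`, `B ∈ E(K[n])`.
* `kolyvaginClass_congr_subgroup`, `exists_isCoprime_kolyvaginClass_eq_smul` — `c_M(d₂) = u • c_M(d₁)` (junk values included).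
* `addOrderOf_zsmul_eq_of_isCoprime`, `addOrderOf_map_kolyvaginClass_eq` — `addOrderOf (φ c_M(d₂)) = addOrderOf (φ c_M(d₁))` for
  every additive `φ` (e.g. `loc_v`): the local orders of tam3-p1's `h47` ∕ `hCeb` bookkeeping depend on `(n, ys n)` only.

HONEST FRAMING. Helper lemmas toward crux 21420 `CornerAtThreeW` (line `Lines/inert.lean` r7, stub `stub_upper3_residualMulti`) and
19109; nothing about BSD, `J₃`, or any divisibility of a Heegner point is asserted; no stub is discharged; no item closes; 0 classes
move (T7). `K : Type`. References: [cite: GrossLMS1991, Prop. 3.6, §4 (4.1)–(4.4)] [cite: McCallumLMS1991, §4 (4)–(6)]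
[cite: Cox2013, §9.A Lemma 9.3]. Axioms: `propext`, `Classical.choice`, `Quot.sound`. -/

set_option autoImplicit false
set_option linter.dupNamespace false

noncomputable section

open scoped Classical

namespace Summit.BirchSwinnertonDyer.BirchSwinnertonDyer.Theorems.ShimuraWalk

open WeierstrassCurve Field NumberField IsDedekindDomain Finset
  Literature.NumberTheory.EllipticCurves Literature.NumberTheory.GaloisRepresentations
  Literature.NumberTheory.EllipticCurves.KolyvaginCocycle
  Literature.NumberTheory.EllipticCurves.KolyvaginEuler
  Literature.NumberTheory.EllipticCurves.RingClassField
  Literature.NumberTheory.EllipticCurves.ModularForms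
  Summit.BirchSwinnertonDyer.Rank1Residual.X11b
  Summit.BirchSwinnertonDyer.Rank1Residual.JET
  Summit.BirchSwinnertonDyer.BirchSwinnertonDyer.Theorems

variable {K : Type} [Field K] [NumberField K] {W : WeierstrassCurve ℚ}

/-! ## §1 The datum as a presentation in `𝒢_n` -/

/-- **A generalised Kolyvagin datum is a PRESENTATION.** In `𝒢_n = Gal(K[n]/K)` (abelian), with `H_c` the pull-back of `G_n =
Gal(K[n]/K[1])`, the datum `d` gives generators `σ_q ∈ 𝒢_n` (`σ_q^{q+1} = 1`), a section `f` of `𝒢_n → 𝒢_n/H_c` valued in `d.S`, and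
the abstract Kolyvagin point `P(σ, f, y(n)) = Σ_c f(c) D_n y(n)` IS `d.derivedPoint` (x11b3's H37 bridge). p599103's
`exists_levelData_familyData` for a single datum, without the embedding data. [cite: GrossLMS1991, §3 (3.4)–(3.5), §4 (4.1)] -/
theorem exists_familyData_presentation (hK : IsImaginaryQuadratic K) (ι : K →+* ℂ) {n : ℕ} (hn : Squarefree n)
    (hinert : ∀ q ∈ n.primeFactors, (Ideal.span {(q : 𝓞 K)}).IsPrime) (d : KolyvaginFamilyData W K ι n) :
    letI : CommGroup (ringClassGal ι n) := { (inferInstance : Group (ringClassGal ι n)) with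
      mul_comm := fun a b ↦ (KolyvaginH44.isMulCommutative_ringClassGal' hK ι n).is_comm.comm a b }
    letI : DistribMulAction (ringClassGal ι n) ((W.baseChange (ringClassField K ι n)).toAffine.Point) :=
      DistribMulAction.compHom _ ((pointGalHom W (ringClassField K ι n)).comp (ringClassGal ι n).subtype)
    ∃ (σ : ℕ → ringClassGal ι n) (H : Subgroup (ringClassGal ι n)) (_ : Fintype (ringClassGal ι n ⧸ H))
      (f : ringClassGal ι n ⧸ H → ringClassGal ι n),
      (∀ q ∈ n.primeFactors, σ q ^ (q + 1) = 1) ∧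
      (∀ c, (f c : ringClassGal ι n ⧸ H) = c) ∧
      (∀ c, (f c : ringClassField K ι n ≃ₐ[ℚ] ringClassField K ι n) ∈ d.S) ∧
      (∀ h ∈ H, (h : ringClassField K ι n ≃ₐ[ℚ] ringClassField K ι n) ∈ ringClassGalOver ι n 1) ∧
      (∀ q ∈ n.primeFactors, (σ q : ringClassField K ι n ≃ₐ[ℚ] ringClassField K ι n) = d.σ q) ∧
      kolyvaginPoint σ n.primeFactors f d.y = d.derivedPoint := by
  -- adapted from p599103 `exists_levelData_familyData`
  letI hcg : CommGroup (ringClassGal ι n) := { (inferInstance : Group (ringClassGal ι n)) with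
    mul_comm := fun a b ↦ (KolyvaginH44.isMulCommutative_ringClassGal' hK ι n).is_comm.comm a b }
  letI act : DistribMulAction (ringClassGal ι n) ((W.baseChange (ringClassField K ι n)).toAffine.Point) :=
    DistribMulAction.compHom _ ((pointGalHom W (ringClassField K ι n)).comp (ringClassGal ι n).subtype)
  haveI : Finite (ringClassGal ι n) := KolyvaginH44.finite_ringClassGal hK ι n
  set ρ : ringClassGal ι n →* (ringClassField K ι n ≃ₐ[ℚ] ringClassField K ι n) := (ringClassGal ι n).subtype with hρ
  have hρi : Function.Injective ρ := (ringClassGal ι n).subtype_injective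
  have hsmul : ∀ (g : ringClassGal ι n) (Q : (W.baseChange (ringClassField K ι n)).toAffine.Point),
      g • Q = pointGalHom W (ringClassField K ι n) (ρ g) Q := fun _ _ ↦ rfl
  set Hc : Subgroup (ringClassGal ι n) := (ringClassGalOver ι n 1).comap ρ with hHc
  letI hF : Fintype (ringClassGal ι n ⧸ Hc) := Fintype.ofFinite _
  have hHc' : ∀ h ∈ Hc, ρ h ∈ ringClassGalOver ι n 1 := fun h hh ↦ Subgroup.mem_comap.mp hh
  have hSρ : ((d.S : Set (ringClassField K ι n ≃ₐ[ℚ] ringClassField K ι n))) ⊆ Set.range ρ :=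
    fun s hs ↦ ⟨⟨s, d.S_subset s hs⟩, rfl⟩
  obtain ⟨f, hf, hfS⟩ := exists_section_comap_of_transversal ι n ρ (fun g ↦ g.2) hSρ d.S_transversal
  have hσmem : ∀ q ∈ n.primeFactors, d.σ q ∈ ringClassGal ι n := fun q hq ↦
    ringClassGalOver_le_ringClassGal ι n (n / q) ((d.zpowers_σ q hq) ▸ Subgroup.mem_zpowers _)
  let σ : ℕ → ringClassGal ι n := fun q ↦ if hq : q ∈ n.primeFactors then ⟨d.σ q, hσmem q hq⟩ else 1
  have hσ : ∀ q ∈ n.primeFactors, (σ q : ringClassField K ι n ≃ₐ[ℚ] ringClassField K ι n) = d.σ q :=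
    fun q hq ↦ by simp only [σ, dif_pos hq]
  have hbij := KolyvaginH37Bridge.bijOn_of_section_of_transversal ρ hρi (H := Hc)
    (Γ := ringClassGal ι n) (G₁ := ringClassGalOver ι n 1) hHc'
    (S := (↑d.S : Set (ringClassField K ι n ≃ₐ[ℚ] ringClassField K ι n)))
    (fun s hs ↦ d.S_subset s hs) hSρ (fun g hg ↦ d.S_transversal g hg) f hf hfS
  have hbr : kolyvaginPoint σ n.primeFactors f d.y = d.derivedPoint := by
    have h := KolyvaginH37Bridge.map_kolyvaginPoint_eq_derivedPoint (pointGalHom W (ringClassField K ι n))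
      ρ (AddMonoidHom.id ((W.baseChange (ringClassField K ι n)).toAffine.Point)) (fun g a ↦ hsmul g a)
      hn (τ := d.σ) hσ f hbij d.y
    rw [AddMonoidHom.id_apply, AddMonoidHom.id_apply] at h
    exact h
  refine ⟨σ, Hc, hF, f, fun q hq ↦ Subtype.ext ?_, hf, hfS, hHc', hσ, hbr⟩
  rw [SubmonoidClass.coe_pow, hσ q hq, OneMemClass.coe_one]
  exact familyData_σ_pow_succ_eq_one hK d hn hq (hinert q hq)

/-! ## §2 `P₂ = u • P₁ + p^M b` in `E(K[n])` -/

/-- **Two data with the same `y(n)` have proportional derived points modulo `p^M`, with a unit ratio** (Gross 1991 §3–§4: the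
class of `D_n y_n`, hence of `P_n`, modulo `p^M` is canonical up to the choices; shim-p1's CHOICE-FREE comparison of two transversal
presentations): `d₂.derivedPoint = u • d₁.derivedPoint + p^M • b` with `IsCoprime u p^M`, for `d₂.y = d₁.y`, `n` square-free with
Gross–Kolyvagin prime factors satisfying (3.2) modulo `p^M` (`M ≥ 1`) and (B4) at level `n`.
[cite: GrossLMS1991, §3 Prop. 3.6, §4 (4.1)] [cite: McCallumLMS1991, §4 (4)] -/
theorem exists_isCoprime_derivedPoint_eq_smul_add {N : ℕ} [NeZero N] [W.IsElliptic] [W.IsGloballyMinimal]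
    (hK : IsImaginaryQuadratic K) (ι : K →+* ℂ) (Dt : ModularParametrizationData W N) {p M : ℕ} (hp : p.Prime) (hM : 1 ≤ M)
    {n : ℕ} (hn : Squarefree n)
    (hKol : ∀ q ∈ n.primeFactors, IsKolyvaginPrime N W K p q ∧ FrobEqFrobInfty W K (p ^ M) q)
    (d₁ d₂ : KolyvaginFamilyData W K ι n) (hy : d₂.y = d₁.y)
    (hB4 : ∀ ℓ ∈ n.primeFactors, ∀ σ : ringClassField K ι n ≃ₐ[ℚ] ringClassField K ι n,
      Subgroup.zpowers σ = ringClassGalOver ι n (n / ℓ) →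
      ∃ y' : (W.baseChange (ringClassField K ι n)).toAffine.Point,
        ∑ i ∈ Finset.range (ℓ + 1), pointGalHom W (ringClassField K ι n) (σ ^ i) d₁.y = W.frobeniusTrace ℓ • y') :
    ∃ u : ℤ, IsCoprime u ((p ^ M : ℕ) : ℤ) ∧ ∃ b : (W.baseChange (ringClassField K ι n)).toAffine.Point,
      d₂.derivedPoint = u • d₁.derivedPoint + ((p ^ M : ℕ) : ℤ) • b := by
  letI hcg : CommGroup (ringClassGal ι n) := { (inferInstance : Group (ringClassGal ι n)) with
    mul_comm := fun a b ↦ (KolyvaginH44.isMulCommutative_ringClassGal' hK ι n).is_comm.comm a b }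
  letI act : DistribMulAction (ringClassGal ι n) ((W.baseChange (ringClassField K ι n)).toAffine.Point) :=
    DistribMulAction.compHom _ ((pointGalHom W (ringClassField K ι n)).comp (ringClassGal ι n).subtype)
  haveI : Finite (ringClassGal ι n) := KolyvaginH44.finite_ringClassGal hK ι n
  set ρ : ringClassGal ι n →* (ringClassField K ι n ≃ₐ[ℚ] ringClassField K ι n) := (ringClassGal ι n).subtype with hρ
  have hρi : Function.Injective ρ := (ringClassGal ι n).subtype_injective
  have hinert : ∀ q ∈ n.primeFactors, (Ideal.span {(q : 𝓞 K)}).IsPrime := fun q hq ↦ (hKol q hq).1.2.2.2.2.1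
  obtain ⟨σ₁, H₁, hF₁, f₁, hord₁, hf₁, hf₁S, hH₁, hσ₁, hP₁⟩ := exists_familyData_presentation (W := W) hK ι hn hinert d₁
  obtain ⟨σ₂, H₂, hF₂, f₂, -, hf₂, hf₂S, hH₂, hσ₂, hP₂⟩ := exists_familyData_presentation (W := W) hK ι hn hinert d₂
  letI := hF₁
  letI := hF₂
  have hz : ∀ (d : KolyvaginFamilyData W K ι n) (σ : ℕ → ringClassGal ι n),
      (∀ q ∈ n.primeFactors, (σ q : ringClassField K ι n ≃ₐ[ℚ] ringClassField K ι n) = d.σ q) →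
      ∀ q ∈ n.primeFactors, (Subgroup.zpowers (σ q)).map ρ = ringClassGalOver ι n (n / q) := by
    intro d σ hσ q hq
    rw [MonoidHom.map_zpowers]
    change Subgroup.zpowers (σ q : ringClassField K ι n ≃ₐ[ℚ] ringClassField K ι n) = _
    rw [hσ q hq]; exact d.zpowers_σ q hq
  have hSρ : ∀ d : KolyvaginFamilyData W K ι n,
      ((d.S : Set (ringClassField K ι n ≃ₐ[ℚ] ringClassField K ι n))) ⊆ Set.range ρ :=
    fun d s hs ↦ ⟨⟨s, d.S_subset s hs⟩, rfl⟩
  obtain ⟨u, hu, b, hb⟩ := exists_isCoprime_kolyvaginPoint_eq_of_presentations_of_pow_eq_one hK ι Dt hp hM hn hKol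
    ρ hρi (fun g ↦ g.2) (AddEquiv.refl _) (fun _ _ ↦ rfl) d₁.y hB4
    σ₁ H₁ f₁ d₁.S hH₁ hf₁ hf₁S d₁.S_subset (hSρ d₁) d₁.S_transversal (hz d₁ σ₁ hσ₁) hord₁
    σ₂ H₂ f₂ d₂.S hH₂ hf₂ hf₂S d₂.S_subset (hSρ d₂) d₂.S_transversal (hz d₂ σ₂ hσ₂)
  refine ⟨u, hu, b, ?_⟩
  rw [← hP₂, hy, hb, hP₁]

/-! ## §3 Two data at one level have the same `E(K[n]) ⊆ E(K̄)` -/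

section Points

variable {ι : K →+* ℂ} {n : ℕ} (d₁ d₂ : KolyvaginFamilyData W K ι n)

/-- If `d₂.emb = d₁.emb ∘ γ` for `γ ∈ Aut_ℚ(K[n])`, then `j₂ = j₁ ∘ γ` on `E(K[n])` (coordinatewise). [cite: GrossLMS1991, §4 (4.1)–(4.2)] -/
theorem familyData_toGeomPoints_eq_of_emb {γ : ringClassField K ι n ≃ₐ[ℚ] ringClassField K ι n}
    (h : ∀ x, d₂.emb x = d₁.emb (γ x)) (P : (W.baseChange (ringClassField K ι n)).toAffine.Point) :
    d₂.toGeomPoints P = d₁.toGeomPoints (pointGalHom W (ringClassField K ι n) γ P) := by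
  rcases P with _ | ⟨x, y, hxy⟩
  · change d₂.toGeomPoints 0 = d₁.toGeomPoints (pointGalHom W (ringClassField K ι n) γ 0)
    rw [map_zero, map_zero, map_zero]
  · have hns₂ : ((W.baseChange K).baseChange (AlgebraicClosure K)).toAffine.Nonsingular (d₂.emb x) (d₂.emb y) :=
      (Affine.baseChange_nonsingular W d₂.emb.toRatAlgHom.injective x y).mpr hxy
    have hγ : (W.baseChange (ringClassField K ι n)).toAffine.Nonsingular (γ x) (γ y) :=
      (Affine.baseChange_nonsingular W (γ : ringClassField K ι n →ₐ[ℚ] ringClassField K ι n).injective x y).mpr hxy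
    have hns₁ : ((W.baseChange K).baseChange (AlgebraicClosure K)).toAffine.Nonsingular (d₁.emb (γ x)) (d₁.emb (γ y)) :=
      (Affine.baseChange_nonsingular W d₁.emb.toRatAlgHom.injective (γ x) (γ y)).mpr hγ
    have h2 : d₂.toGeomPoints (.some x y hxy) = .some (d₂.emb x) (d₂.emb y) hns₂ := by
      change Affine.Point.map (W' := W) d₂.emb.toRatAlgHom (.some x y hxy) = _
      rw [Affine.Point.map_some]
      rfl
    have h1 : d₁.toGeomPoints (pointGalHom W (ringClassField K ι n) γ (.some x y hxy)) =
        .some (d₁.emb (γ x)) (d₁.emb (γ y)) hns₁ := by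
      change Affine.Point.map (W' := W) d₁.emb.toRatAlgHom
        (Affine.Point.map (W' := W) (γ : ringClassField K ι n →ₐ[ℚ] ringClassField K ι n) (.some x y hxy)) = _
      rw [Affine.Point.map_some, Affine.Point.map_some]
      rfl
    rw [h2, h1]
    exact Affine.Point.some_eq_some_of_eq (h x) (h y)

/-- **Two data at one level have the same subgroup `E(K[n]) ⊆ E(K̄)`**: two `K`-embeddings `K[n] → K̄` of the Galois extension
`K[n]/K` differ by an automorphism `γ` of `K[n]` (`RingClassConj.exists_algEquiv_forall_apply_eq`), and `E(K[n])` is `γ`-stable.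
[cite: Cox2013, §9.A Lemma 9.3] [cite: GrossLMS1991, §4 (4.2)] -/
theorem familyData_pointsSubgroup_eq (hK : IsImaginaryQuadratic K) (hn : n ≠ 0) : d₂.pointsSubgroup = d₁.pointsSubgroup := by
  have key : ∀ (e₁ e₂ : KolyvaginFamilyData W K ι n), e₂.pointsSubgroup ≤ e₁.pointsSubgroup := by
    intro e₁ e₂
    obtain ⟨γ, hγ⟩ := RingClassConj.exists_algEquiv_forall_apply_eq hK ι hn e₁.emb e₂.emb
    rintro _ ⟨P, rfl⟩
    exact ⟨pointGalHom W (ringClassField K ι n) γ P, (familyData_toGeomPoints_eq_of_emb e₁ e₂ hγ P).symm⟩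
  exact le_antisymm (key d₁ d₂) (key d₂ d₁)

end Points

/-! ## §4 `j₂ P₂ = u • j₁ P₁ + p^M • B` in `E(K̄)` and `c_M(d₂) = u • c_M(d₁)` -/

/-- **The derived points of two data with the same `y(n)` inside `E(K̄)`**: `j₂ P₂ = u • j₁ P₁ + p^M • B` with `IsCoprime u p^M`
and `B ∈ E(K[n])` (`= d₁.pointsSubgroup`). From §2, the change of embedding `j₂ = j₁ ∘ γ` (`γ ∈ 𝒢_n`, §3) and the `𝒢_n`-INVARIANCE
of `[P₁]` modulo `p^M` (Gross Prop. 3.6 ∕ McCallum (4), abstract Euler lemma `smul_kolyvaginPoint_sub_mem` on the presentation of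
§1 with the Euler hypotheses from (B4) and (3.3)). [cite: GrossLMS1991, Prop. 3.6, §4 (4.1)] [cite: McCallumLMS1991, §4 (4)] -/
theorem exists_isCoprime_toGeomPoints_derivedPoint_eq_smul_add {N : ℕ} [NeZero N] [W.IsElliptic] [W.IsGloballyMinimal]
    (hK : IsImaginaryQuadratic K) (ι : K →+* ℂ) (Dt : ModularParametrizationData W N) {p M : ℕ} (hp : p.Prime) (hM : 1 ≤ M)
    {n : ℕ} (hn : Squarefree n)
    (hKol : ∀ q ∈ n.primeFactors, IsKolyvaginPrime N W K p q ∧ FrobEqFrobInfty W K (p ^ M) q)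
    (d₁ d₂ : KolyvaginFamilyData W K ι n) (hy : d₂.y = d₁.y)
    (hB4 : ∀ ℓ ∈ n.primeFactors, ∀ σ : ringClassField K ι n ≃ₐ[ℚ] ringClassField K ι n,
      Subgroup.zpowers σ = ringClassGalOver ι n (n / ℓ) →
      ∃ y' : (W.baseChange (ringClassField K ι n)).toAffine.Point,
        ∑ i ∈ Finset.range (ℓ + 1), pointGalHom W (ringClassField K ι n) (σ ^ i) d₁.y = W.frobeniusTrace ℓ • y') :
    ∃ u : ℤ, IsCoprime u ((p ^ M : ℕ) : ℤ) ∧ ∃ B ∈ d₁.pointsSubgroup,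
      d₂.toGeomPoints d₂.derivedPoint = u • d₁.toGeomPoints d₁.derivedPoint + ((p ^ M : ℕ) : ℤ) • B := by
  have hn0 : n ≠ 0 := hn.ne_zero
  letI hcg : CommGroup (ringClassGal ι n) := { (inferInstance : Group (ringClassGal ι n)) with
    mul_comm := fun a b ↦ (KolyvaginH44.isMulCommutative_ringClassGal' hK ι n).is_comm.comm a b }
  letI act : DistribMulAction (ringClassGal ι n) ((W.baseChange (ringClassField K ι n)).toAffine.Point) :=
    DistribMulAction.compHom _ ((pointGalHom W (ringClassField K ι n)).comp (ringClassGal ι n).subtype)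
  haveI : Finite (ringClassGal ι n) := KolyvaginH44.finite_ringClassGal hK ι n
  set ρ : ringClassGal ι n →* (ringClassField K ι n ≃ₐ[ℚ] ringClassField K ι n) := (ringClassGal ι n).subtype with hρ
  have hρi : Function.Injective ρ := (ringClassGal ι n).subtype_injective
  have hsmul : ∀ (g : ringClassGal ι n) (Q : (W.baseChange (ringClassField K ι n)).toAffine.Point),
      g • Q = pointGalHom W (ringClassField K ι n) (g : ringClassField K ι n ≃ₐ[ℚ] ringClassField K ι n) Q :=
    fun _ _ ↦ rfl
  -- §2 in `E(K[n])`
  obtain ⟨u, hu, b, hb⟩ := exists_isCoprime_derivedPoint_eq_smul_add (W := W) hK ι Dt hp hM hn hKol d₁ d₂ hy hB4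
  -- the change of embedding `γ ∈ 𝒢_n`
  obtain ⟨γ, hγ⟩ := RingClassConj.exists_algEquiv_forall_apply_eq hK ι hn0 d₁.emb d₂.emb
  have hγK : γ ∈ ringClassGal ι n := by
    rw [mem_ringClassGal_iff_forall_apply_algebraMap]
    intro k
    apply d₁.emb.toRatAlgHom.injective
    change d₁.emb (γ (algebraMap K (ringClassField K ι n) k)) = d₁.emb (algebraMap K (ringClassField K ι n) k)
    rw [← hγ, d₂.emb_apply, d₁.emb_apply]
  -- `𝒢_n`-invariance of `[P₁]` modulo `p^M` (presentation of §1 + abstract Euler lemma)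
  have hinert : ∀ q ∈ n.primeFactors, (Ideal.span {(q : 𝓞 K)}).IsPrime := fun q hq ↦ (hKol q hq).1.2.2.2.2.1
  obtain ⟨σ₁, H₁, hF₁, f₁, hord₁, hf₁, -, hH₁, hσ₁, hP₁⟩ := exists_familyData_presentation (W := W) hK ι hn hinert d₁
  letI := hF₁
  have hgen : H₁ ≤ Subgroup.closure (σ₁ '' (n.primeFactors : Set ℕ)) :=
    le_closure_of_map_zpowers hK ι hn σ₁ H₁ ρ hρi
      (fun q hq ↦ by
        rw [MonoidHom.map_zpowers]
        change Subgroup.zpowers (σ₁ q : ringClassField K ι n ≃ₐ[ℚ] ringClassField K ι n) = _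
        rw [hσ₁ q hq]; exact d₁.zpowers_σ q hq)
      hH₁
  have hdvd : ∀ ℓ ∈ n.primeFactors, ((p ^ M : ℕ) : ℤ) ∣ ((ℓ + 1 : ℕ) : ℤ) := fun ℓ hℓ ↦
    (IsKolyvaginPrime.pow_dvd_add_one W hp (hKol ℓ hℓ).1 hM (hKol ℓ hℓ).2).1
  have htr : ∀ ℓ ∈ n.primeFactors,
      grAct ((W.baseChange (ringClassField K ι n)).toAffine.Point) (traceElt (σ₁ ℓ) ℓ) d₁.y ∈
        zsmulRange ((W.baseChange (ringClassField K ι n)).toAffine.Point) ((p ^ M : ℕ) : ℤ) := by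
    intro ℓ hℓ
    obtain ⟨y', hy'⟩ := hB4 ℓ hℓ (d₁.σ ℓ) (d₁.zpowers_σ ℓ hℓ)
    have hrel : grAct ((W.baseChange (ringClassField K ι n)).toAffine.Point) (traceElt (σ₁ ℓ) ℓ) d₁.y =
        W.frobeniusTrace ℓ • y' := by
      rw [grAct_traceElt, ← hy']
      refine Finset.sum_congr rfl fun i _ ↦ ?_
      rw [hsmul, Subgroup.coe_pow, hσ₁ ℓ hℓ]
    exact grAct_traceElt_mem_of_eq_smul hrel
      (pow_dvd_frobeniusTrace_of_kolyvaginPrime (K := K) Dt hp hM (hKol ℓ hℓ).1 (hKol ℓ hℓ).2)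
  obtain ⟨b', hb'⟩ : (⟨γ, hγK⟩ : ringClassGal ι n) • d₁.derivedPoint - d₁.derivedPoint ∈
      zsmulRange ((W.baseChange (ringClassField K ι n)).toAffine.Point) ((p ^ M : ℕ) : ℤ) := by
    rw [← hP₁]
    exact smul_kolyvaginPoint_sub_mem hf₁ hgen hord₁ hdvd htr _
  have hγP : pointGalHom W (ringClassField K ι n) γ d₁.derivedPoint = d₁.derivedPoint + ((p ^ M : ℕ) : ℤ) • b' := by
    have : (⟨γ, hγK⟩ : ringClassGal ι n) • d₁.derivedPoint = d₁.derivedPoint + ((p ^ M : ℕ) : ℤ) • b' := by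
      rw [← sub_eq_iff_eq_add']; exact hb'.symm
    rw [hsmul] at this
    exact this
  -- assemble in `E(K̄)`
  refine ⟨u, hu, u • d₁.toGeomPoints b' + d₁.toGeomPoints (pointGalHom W (ringClassField K ι n) γ b),
    d₁.pointsSubgroup.add_mem (d₁.pointsSubgroup.zsmul_mem ⟨b', rfl⟩ u) ⟨_, rfl⟩, ?_⟩
  rw [familyData_toGeomPoints_eq_of_emb d₁ d₂ hγ, hb, map_add, map_zsmul, map_zsmul, hγP, map_add, map_zsmul,
    map_add, map_zsmul, map_zsmul, smul_add, smul_add, smul_comm u (((p ^ M : ℕ) : ℤ)) (d₁.toGeomPoints b')]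
  abel

omit [NumberField K] in
/-- Kolyvagin's class with respect to EQUAL admissible subgroups `A = A'` is the same class (transport of the proofs). [folklore] -/
theorem kolyvaginClass_congr_subgroup {E : WeierstrassCurve K} {m : ℤ} (hdiv : ∀ P : geomPoints E, ∃ Q : geomPoints E, m • Q = P)
    {A A' : AddSubgroup (geomPoints E)} (h : A = A') (hA : IsAdmissible (absoluteGaloisGroup K) A m)
    {P : geomPoints E} (hP : P ∈ invPoints (absoluteGaloisGroup K) A m)
    (hA' : IsAdmissible (absoluteGaloisGroup K) A' m) (hP' : P ∈ invPoints (absoluteGaloisGroup K) A' m) :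
    kolyvaginClass E m hdiv hA P hP = kolyvaginClass E m hdiv hA' P hP' := by
  subst h
  rfl

/-- **CHOICE-FREENESS of `c_M(n)`**: for two generalised data at level `n` with the same `y(n)` (hypotheses of §2),
`c_M(d₂) = u • c_M(d₁)` with `IsCoprime u p^M` — INCLUDING the junk values (admissibility of `E(K[n])` and invariance of `[P_n]`
hold for `d₂` iff they hold for `d₁`, by §3–§4 applied both ways). [cite: GrossLMS1991, §4 (4.4), Prop. 3.6] [cite: McCallumLMS1991, §4 (4)–(6)] -/
theorem exists_isCoprime_kolyvaginClass_eq_smul {N : ℕ} [NeZero N] [W.IsElliptic] [W.IsGloballyMinimal]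
    (hK : IsImaginaryQuadratic K) (ι : K →+* ℂ) (Dt : ModularParametrizationData W N) {p M : ℕ} (hp : p.Prime) (hM : 1 ≤ M)
    {n : ℕ} (hn : Squarefree n)
    (hKol : ∀ q ∈ n.primeFactors, IsKolyvaginPrime N W K p q ∧ FrobEqFrobInfty W K (p ^ M) q)
    (d₁ d₂ : KolyvaginFamilyData W K ι n) (hy : d₂.y = d₁.y)
    (hB4 : ∀ ℓ ∈ n.primeFactors, ∀ σ : ringClassField K ι n ≃ₐ[ℚ] ringClassField K ι n,
      Subgroup.zpowers σ = ringClassGalOver ι n (n / ℓ) →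
      ∃ y' : (W.baseChange (ringClassField K ι n)).toAffine.Point,
        ∑ i ∈ Finset.range (ℓ + 1), pointGalHom W (ringClassField K ι n) (σ ^ i) d₁.y = W.frobeniusTrace ℓ • y') :
    ∃ u : ℤ, IsCoprime u ((p ^ M : ℕ) : ℤ) ∧ d₂.kolyvaginClass hp M = u • d₁.kolyvaginClass hp M := by
  have hn0 : n ≠ 0 := hn.ne_zero
  have hAeq : d₂.pointsSubgroup = d₁.pointsSubgroup := familyData_pointsSubgroup_eq d₁ d₂ hK hn0
  -- (B4) for `d₂.y = d₁.y` as well, and §4 both ways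
  have hB4' : ∀ ℓ ∈ n.primeFactors, ∀ σ : ringClassField K ι n ≃ₐ[ℚ] ringClassField K ι n,
      Subgroup.zpowers σ = ringClassGalOver ι n (n / ℓ) →
      ∃ y' : (W.baseChange (ringClassField K ι n)).toAffine.Point,
        ∑ i ∈ Finset.range (ℓ + 1), pointGalHom W (ringClassField K ι n) (σ ^ i) d₂.y = W.frobeniusTrace ℓ • y' := by
    rw [hy]; exact hB4
  obtain ⟨u, hu, B, hB, h12⟩ :=
    exists_isCoprime_toGeomPoints_derivedPoint_eq_smul_add (W := W) hK ι Dt hp hM hn hKol d₁ d₂ hy hB4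
  obtain ⟨u', -, B', hB', h21⟩ :=
    exists_isCoprime_toGeomPoints_derivedPoint_eq_smul_add (W := W) hK ι Dt hp hM hn hKol d₂ d₁ hy.symm hB4'
  have hcont := continuous_smul_geomPoints (W.baseChange K)
  by_cases h₁ : IsAdmissible (absoluteGaloisGroup K) d₁.pointsSubgroup ((p ^ M : ℕ) : ℤ) ∧
      d₁.toGeomPoints d₁.derivedPoint ∈ invPoints (absoluteGaloisGroup K) d₁.pointsSubgroup ((p ^ M : ℕ) : ℤ)
  · -- genuine classes on both sides
    obtain ⟨hA, hP⟩ := h₁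
    have huP : u • d₁.toGeomPoints d₁.derivedPoint ∈
        invPoints (absoluteGaloisGroup K) d₁.pointsSubgroup ((p ^ M : ℕ) : ℤ) :=
      (invPoints (absoluteGaloisGroup K) d₁.pointsSubgroup ((p ^ M : ℕ) : ℤ)).zsmul_mem hP u
    have hmB : u • d₁.toGeomPoints d₁.derivedPoint + ((p ^ M : ℕ) : ℤ) • B ∈
        invPoints (absoluteGaloisGroup K) d₁.pointsSubgroup ((p ^ M : ℕ) : ℤ) :=
      (invPoints (absoluteGaloisGroup K) d₁.pointsSubgroup ((p ^ M : ℕ) : ℤ)).add_mem huP (zsmul_mem_invPoints hA hB)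
    have hP₂ : d₂.toGeomPoints d₂.derivedPoint ∈
        invPoints (absoluteGaloisGroup K) d₁.pointsSubgroup ((p ^ M : ℕ) : ℤ) := h12 ▸ hmB
    have h₂ : IsAdmissible (absoluteGaloisGroup K) d₂.pointsSubgroup ((p ^ M : ℕ) : ℤ) ∧
        d₂.toGeomPoints d₂.derivedPoint ∈ invPoints (absoluteGaloisGroup K) d₂.pointsSubgroup ((p ^ M : ℕ) : ℤ) := by
      rw [hAeq]; exact ⟨hA, hP₂⟩
    refine ⟨u, hu, ?_⟩
    rw [d₂.kolyvaginClass_def, dif_pos h₂, d₁.kolyvaginClass_def, dif_pos ⟨hA, hP⟩,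
      kolyvaginClass_congr_subgroup _ hAeq h₂.1 h₂.2 hA hP₂]
    obtain ⟨Q, hQ⟩ := (W.baseChange K).zsmul_geomPoints_surjective_of_charZero (n := ((p ^ M : ℕ) : ℤ))
      (by exact_mod_cast pow_ne_zero M hp.ne_zero) (d₁.toGeomPoints d₁.derivedPoint)
    have hQ : ((p ^ M : ℕ) : ℤ) • Q = d₁.toGeomPoints d₁.derivedPoint := hQ
    have huQ : ((p ^ M : ℕ) : ℤ) • (u • Q) = u • d₁.toGeomPoints d₁.derivedPoint := by rw [smul_comm, hQ]
    have hQB : ((p ^ M : ℕ) : ℤ) • (u • Q + B) = u • d₁.toGeomPoints d₁.derivedPoint + ((p ^ M : ℕ) : ℤ) • B := by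
      rw [smul_add, huQ]
    have hQ₂ : ((p ^ M : ℕ) : ℤ) • (u • Q + B) = d₂.toGeomPoints d₂.derivedPoint := by rw [hQB, ← h12]
    rw [kolyvaginClass_eq_cls hA hP₂ hQ₂, kolyvaginClass_eq_cls hA hP hQ,
      cls_congr hA hcont (hP' := hmB) (hQ' := hQB) h12 rfl,
      cls_add_zsmul hA hcont huP huQ hB hmB hQB, cls_zsmul hA hcont hP hQ u huP huQ]
  · -- junk on both sides
    have h₂ : ¬ (IsAdmissible (absoluteGaloisGroup K) d₂.pointsSubgroup ((p ^ M : ℕ) : ℤ) ∧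
        d₂.toGeomPoints d₂.derivedPoint ∈ invPoints (absoluteGaloisGroup K) d₂.pointsSubgroup ((p ^ M : ℕ) : ℤ)) := by
      rintro ⟨hA₂, hP₂⟩
      apply h₁
      rw [hAeq] at hA₂ hP₂ hB'
      refine ⟨hA₂, ?_⟩
      rw [h21]
      exact (invPoints (absoluteGaloisGroup K) d₁.pointsSubgroup ((p ^ M : ℕ) : ℤ)).add_mem
        ((invPoints (absoluteGaloisGroup K) d₁.pointsSubgroup ((p ^ M : ℕ) : ℤ)).zsmul_mem hP₂ u')
        (zsmul_mem_invPoints hA₂ hB')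
    refine ⟨1, isCoprime_one_left, ?_⟩
    rw [d₂.kolyvaginClass_def, dif_neg h₂, d₁.kolyvaginClass_def, dif_neg h₁, zsmul_zero]

/-! ## §5 Local orders depend on `(n, y(n))` only -/

/-- `addOrderOf (u • y) = addOrderOf y` for `u` prime to an exponent `m` of `y` (Bezout). [folklore] -/
theorem addOrderOf_zsmul_eq_of_isCoprime {X : Type*} [AddCommGroup X] {u m : ℤ} (hu : IsCoprime u m) {y : X}
    (hy : m • y = 0) : addOrderOf (u • y) = addOrderOf y := by
  have hdvd : ∀ (k : ℤ) (z : X), addOrderOf (k • z) ∣ addOrderOf z := fun k z ↦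
    addOrderOf_dvd_iff_nsmul_eq_zero.mpr (by rw [smul_comm, addOrderOf_nsmul_eq_zero, smul_zero])
  refine Nat.dvd_antisymm (hdvd u y) ?_
  obtain ⟨a, b, hab⟩ := hu
  have hy' : y = a • (u • y) := by
    conv_lhs => rw [← one_smul ℤ y, ← hab]
    rw [add_smul, mul_smul, mul_smul, hy, smul_zero, add_zero]
  conv_lhs => rw [hy']
  exact hdvd a _

/-- **The local orders of `c_M(n)` depend on `(n, y(n))` only**: for two generalised data at level `n` with the same `y(n)`
(hypotheses of §2) and ANY additive map `φ` out of `H¹(K, E[p^M])` — e.g. `loc_v`, `v` any place — `addOrderOf (φ c_M(d₂)) =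
addOrderOf (φ c_M(d₁))`. This makes tam3-p1's `h47` (McCallum 4.4 in order form) and every `addOrderOf ∘ loc_v` bookkeeping of the
walk insensitive to the datum. [cite: McCallumLMS1991, §4 Prop. 4.4, Cor. 4.5] [cite: GrossLMS1991, §4 (4.4)] [cite: SilvermanAEC2009, X.§4] -/
theorem addOrderOf_map_kolyvaginClass_eq {N : ℕ} [NeZero N] [W.IsElliptic] [W.IsGloballyMinimal]
    (hK : IsImaginaryQuadratic K) (ι : K →+* ℂ) (Dt : ModularParametrizationData W N) {p M : ℕ} (hp : p.Prime) (hM : 1 ≤ M)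
    {n : ℕ} (hn : Squarefree n)
    (hKol : ∀ q ∈ n.primeFactors, IsKolyvaginPrime N W K p q ∧ FrobEqFrobInfty W K (p ^ M) q)
    (d₁ d₂ : KolyvaginFamilyData W K ι n) (hy : d₂.y = d₁.y)
    (hB4 : ∀ ℓ ∈ n.primeFactors, ∀ σ : ringClassField K ι n ≃ₐ[ℚ] ringClassField K ι n,
      Subgroup.zpowers σ = ringClassGalOver ι n (n / ℓ) →
      ∃ y' : (W.baseChange (ringClassField K ι n)).toAffine.Point,
        ∑ i ∈ Finset.range (ℓ + 1), pointGalHom W (ringClassField K ι n) (σ ^ i) d₁.y = W.frobeniusTrace ℓ • y')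
    {X : Type*} [AddCommGroup X] (φ : galH1Torsion (W.baseChange K) ((p ^ M : ℕ) : ℤ) →+ X) :
    addOrderOf (φ (d₂.kolyvaginClass hp M)) = addOrderOf (φ (d₁.kolyvaginClass hp M)) := by
  obtain ⟨u, hu, h⟩ := exists_isCoprime_kolyvaginClass_eq_smul (W := W) hK ι Dt hp hM hn hKol d₁ d₂ hy hB4
  rw [h, map_zsmul]
  refine addOrderOf_zsmul_eq_of_isCoprime hu ?_
  rw [← map_zsmul, zsmul_galH1Torsion_eq_zero, map_zero]

end Summit.BirchSwinnertonDyer.BirchSwinnertonDyer.Theorems.ShimuraWalk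

end
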